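import Summits.MatrixMultiplication.OmegaCensus.SmallFormats.MatMul22nRankGF7Slack6SearchSem
import HarnessLib

/-!
# ω-census family (a): semantics of the slack-6 search checker K6, part 2 — determined levels, heptad test, digit expansion, states

Cell `pub-omega` (unit `pub-omega-tensor-g17`, landed by `pub-omega-tensor-g18`), topic `Summits/MatrixMultiplication/OmegaCensus` (sub-folder `SmallFormats`).
Framing (verbatim): lottery ticket; floor = certified bounds/negative ranges. HONEST FRAMING: kernel infrastructure — continuation of
`MatMul22nRankGF7Slack6SearchSem` (`pub-omega-tensor-g17/KERNEL-S6-DESIGN.md` §2): `det_coord6`/`detRes6_eq` (at a determined level each coset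
count equals its residue and `detRes6` computes the true column), `hepOK6_pat` (the masked block heptad test passes on a slack-6 pattern),
`expL6_eq` (digit expansion), `stateW6_succ`/`repW6_eq`/`state2_6_eq` (the true states). Nothing here is progress on `ω`.
-/

namespace Summit.MatrixMultiplication.OmegaCensus.SmallFormats

open Finset
open Literature.NumberTheory.NumberFields (list_sum_range_map)

set_option exponentiation.threshold 100000

attribute [local irreducible] fidx6 crossRel6 fz6 relA6 relE6 relCL6 relD6 relCD6 ag6 exp4Tab6

/-! ## Determined levels -/

set_option maxHeartbeats 8000000 in
/-- **The functional of the relation pinning coordinate `z` of determined level `L`**: the coordinate itself plus the free part. -/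
theorem relVal7_det6 {L : ℕ} (hL : L < 21) {z : ℕ} (hz : z < 42) (x : ℕ → ℕ)
    (hfact : ∀ u : Fin 882, fld 3 (relA6 (levStart6 L + z)) u.val = coefDet6 L z u.val) :
    relVal7 (relA6 (levStart6 L + z)) x = (colN7 x (torOf6 L) z : ℤ)
      + ∑ i ∈ range (k6Base L), (dcoN6 L z i : ℤ) * (fvec6 x i : ℤ) := by
  have hN : k6Base L ≤ 73 := (lev6_ok' hL).2.1
  have ht : torOf6 L < 21 := torOf6_lt hL
  unfold relVal7
  have hd : ∀ u ∈ range 882, (fld 3 (relA6 (levStart6 L + z)) u : ℤ) * xrs7 x (cosetRow7 (u / 42) (u % 42))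
      = (if u = 42 * torOf6 L + z then (1 : ℤ) else 0) * colZ6 x u
        + (if 0 < fidx6 u ∧ fidx6 u - 1 < k6Base L then (dcoN6 L z (fidx6 u - 1) : ℤ) else 0) * colZ6 x u := by
    intro u hu
    have e : fld 3 (relA6 (levStart6 L + z)) u = coefDet6 L z u := hfact ⟨u, mem_range.1 hu⟩
    rw [e, show xrs7 x (cosetRow7 (u / 42) (u % 42)) = colZ6 x u from by unfold colZ6; rw [colN7_cast]]; exact coefDet6_mul L z u _
  rw [sum_congr rfl hd, sum_add_distrib, sum_free6 hN (dcoN6 L z) (colZ6 x)]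
  have e1 : ∑ u ∈ range 882, (if u = 42 * torOf6 L + z then (1 : ℤ) else 0) * colZ6 x u = (colN7 x (torOf6 L) z : ℤ) := by
    simp_rw [ite_mul, one_mul, zero_mul]
    rw [Finset.sum_ite_eq' (range 882) (42 * torOf6 L + z) (colZ6 x), if_pos (mem_range.2 (by omega))]
    unfold colZ6
    rw [show (42 * torOf6 L + z) / 42 = torOf6 L by omega, show (42 * torOf6 L + z) % 42 = z by omega]
  have e2 : ∑ i ∈ range (k6Base L), (dcoN6 L z i : ℤ) * colZ6 x (fcoord6 i) = ∑ i ∈ range (k6Base L), (dcoN6 L z i : ℤ) * (fvec6 x i : ℤ) := by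
    refine sum_congr rfl fun i hi => ?_
    have hi' := mem_range.1 hi
    unfold colZ6
    rw [colN7_fcoord6 x (by omega)]
  rw [e1, e2]

/-- **At a determined level every coset count equals its residue** (LP-tight point of slack 6, columns slack-6 patterns). -/
theorem det_coord6 {L : ℕ} (hL : L < 21) {z : ℕ} (hz : z < 42) (x : ℕ → ℕ) (hx : ∀ j < 21, ∀ z < 42, colN7 x j z ≤ 6)
    (hT : ∀ t < 384, xrs7 x t = 6) (hR : ∀ k < 8, xrs7 x (1266 + k) = 2 * (6 : ℤ))
    (hfact : ∀ u : Fin 882, fld 3 (relA6 (levStart6 L + z)) u.val = coefDet6 L z u.val) (hr : levStart6 L + z < 785)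
    (hc : dccoef6 L z = relC6 (levStart6 L + z)) (hd : ∀ i < k6Base L, dcoef6 L z i ≤ 6) :
    colN7 x (torOf6 L) z = (dccoef6 L z + ∑ i ∈ range (k6Base L), dcoef6 L z i * fvec6 x i) % 7 := by
  obtain ⟨hok, hconst⟩ := relOK6 hr
  have h := rel7_of_relOK7 hok 6 x (fun t ht => by exact_mod_cast hT t ht) hR
  rw [relVal7_det6 hL hz x hfact, ← relConstL7_eq] at h
  have h2 : (((colN7 x (torOf6 L) z + ∑ i ∈ range (k6Base L), dcoN6 L z i * fvec6 x i : ℕ) : ℤ)) % 7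
      = (((6 * relConstL7 (relW6 (levStart6 L + z))) % 7 : ℕ) : ℤ) := by
    push_cast at h ⊢; rw [h]
  rw [← hconst] at h2
  have h3 : (colN7 x (torOf6 L) z + ∑ i ∈ range (k6Base L), dcoN6 L z i * fvec6 x i) % 7 = relC6 (levStart6 L + z) := by omega
  have h12 : (∑ i ∈ range (k6Base L), dcoN6 L z i * fvec6 x i + ∑ i ∈ range (k6Base L), dcoef6 L z i * fvec6 x i) % 7 = 0 := by
    have hz' : ∀ i ∈ range (k6Base L), (dcoN6 L z i * fvec6 x i + dcoef6 L z i * fvec6 x i) % 7 = 0 := by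
      intro i hi
      unfold dcoN6; rw [← add_mul, Nat.mul_mod, neg7_add _ (hd i (mem_range.1 hi))]; simp
    rw [← sum_add_distrib, Finset.sum_nat_mod, sum_eq_zero hz', Nat.zero_mod]
  have hA6 : colN7 x (torOf6 L) z ≤ 6 := hx _ (torOf6_lt hL) _ hz
  rw [hc, ← h3]
  omega

/-- **Generic determined-level computation.** Blocks of dot products plus constants, reduced mod 7. -/
theorem detRes_generic {f : ℕ → ℕ} {N : ℕ} (hN : 0 < N) (hN73 : N ≤ 73) (hf : ∀ i < N, f i ≤ 6)
    {e : ℕ → ℕ → ℕ} (he : ∀ z < 42, ∀ i < N, e z i ≤ 6) {c : ℕ → ℕ} (hc : ∀ z < 42, c z < 7) (E C V : ℕ)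
    (hE : E = packW 1752 (fun z => packW 12 (fun k => e z (N - 1 - k)) N) 42) (hC : C = packW 1752 c 42)
    (hVdef : V = (((packW 12 f N * E) >>> (12 * (N - 1))) &&& laneMask12 42) + C) :
    V - 7 * (((V * 18725) >>> 17) &&& laneMask12 42) = packW 1752 (fun z => (c z + ∑ i ∈ range N, f i * e z i) % 7) 42 := by
  have hV : V = packW 1752 (fun z => ∑ i ∈ range N, f i * e z i + c z) 42 := by
    rw [hVdef, hE, hC, blocks_dot hN hN73 hf he, ← packW_add]
  have hv : ∀ z < 42, (fun z => ∑ i ∈ range N, f i * e z i + c z) z < 2 ^ 14 := by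
    intro z hz
    show ∑ i ∈ range N, f i * e z i + c z < 2 ^ 14
    calc ∑ i ∈ range N, f i * e z i + c z ≤ ∑ i ∈ range N, 6 * 6 + 7 :=
          Nat.add_le_add (sum_le_sum fun i hi => Nat.mul_le_mul (hf i (mem_range.1 hi)) (he z hz i (mem_range.1 hi))) (hc z hz).le
      _ ≤ 73 * (6 * 6) + 7 := by simp only [sum_const, card_range, smul_eq_mul]; nlinarith
      _ < 2 ^ 14 := by norm_num
  rw [hV, blocks_resid hv]
  exact packW_congr 1752 fun z _ => by rw [add_comm (c z)]

set_option maxRecDepth 20000 in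
set_option maxHeartbeats 4000000 in
/-- **`detRes6` computes the true column of a determined level** (as a block vector). -/
theorem detRes6_eq {L : ℕ} (hL : L < 21) (hL1 : 1 ≤ L) (x : ℕ → ℕ) (hx : ∀ j < 21, ∀ z < 42, colN7 x j z ≤ 6)
    (hT : ∀ t < 384, xrs7 x t = 6) (hR : ∀ k < 8, xrs7 x (1266 + k) = 2 * (6 : ℤ))
    (hfacts : ∀ z < 42, (∀ u : Fin 882, fld 3 (relA6 (levStart6 L + z)) u.val = coefDet6 L z u.val) ∧
      dccoef6 L z = relC6 (levStart6 L + z) ∧ (∀ i < k6Base L, dcoef6 L z i ≤ 6))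
    (hshape : relD6 L = packW 1752 (fun z => packW 12 (fun k => dcoef6 L z (k6Base L - 1 - k)) (k6Base L)) 42 ∧
      relCD6 L = packW 1752 (dccoef6 L) 42) (hls : levStart6 L + 41 < 785) :
    detRes6 L (stateW6 x L) = packW 1752 (colN7 x (torOf6 L)) 42 := by
  obtain ⟨_, hN73, h18, _, _, _, _⟩ := lev6_ok' hL
  have hN0 : 0 < k6Base L := by have := h18 hL1; omega
  have hf : ∀ i < k6Base L, fvec6 x i ≤ 6 := fun i hi => fvec6_le hx (by omega)
  have hc7 : ∀ z < 42, dccoef6 L z < 7 := fun z hz => by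
    rw [(hfacts z hz).2.1, (relOK6 (show levStart6 L + z < 785 by omega)).2]; exact Nat.mod_lt _ (by norm_num)
  have key := detRes_generic hN0 hN73 hf (fun z hz i hi => (hfacts z hz).2.2 i hi) hc7 (relD6 L) (relCD6 L) (detV6 L (stateW6 x L))
    hshape.1 hshape.2 rfl
  have e2 : detRes6 L (stateW6 x L) = detV6 L (stateW6 x L) - 7 * (((detV6 L (stateW6 x L) * 18725) >>> 17) &&& laneMask12 42) := rfl
  rw [e2, key]
  refine packW_congr 1752 fun z hz => ?_
  obtain ⟨hfact, hc, hd⟩ := hfacts z hz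
  rw [det_coord6 hL hz x hx hT hR hfact (by omega) hc hd]
  exact congrArg (· % 7) (congrArg (dccoef6 L z + ·) (sum_congr rfl fun i _ => mul_comm _ _))

/-! ## The heptad test on a slack-6 pattern -/

/-- Membership of a point in heptad `hb`. -/
def inHept6 (hb c : ℕ) : Bool := (List.range 7).any fun t => heptPt7 (hb / 6) (hb % 6) t == c

/-- The heptad mask is the block vector selecting the 7 points of the heptad. -/
theorem hm6_eq {hb : ℕ} (hhb : hb < 48) : hm6 hb = packW 1752 (fun c => if inHept6 hb c then 2 ^ 12 - 1 else 0) 42 := by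
  have hy : hb / 6 < 8 := by omega
  have hb6 : hb % 6 < 6 := Nat.mod_lt _ (by norm_num)
  have hinj : ∀ t ∈ range 7, ∀ t' ∈ range 7, heptPt7 (hb / 6) (hb % 6) t = heptPt7 (hb / 6) (hb % 6) t' → t = t' := by
    intro t ht t' ht' h
    have := heptPt7_inj ⟨_, hy⟩ ⟨_, hb6⟩ ⟨t, mem_range.1 ht⟩ ⟨t', mem_range.1 ht'⟩ h
    simpa using this
  unfold hm6 packW
  rw [list_sum_range_map]
  rw [show ∑ t ∈ range 7, (2 ^ 12 - 1) * 2 ^ (1752 * heptPt7 (hb / 6) (hb % 6) t)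
      = ∑ c ∈ (range 7).image (heptPt7 (hb / 6) (hb % 6)), (2 ^ 12 - 1) * 2 ^ (1752 * c) from by rw [sum_image hinj]]
  apply sum_subset_zero_on_sdiff
  · intro c hc; rw [mem_image] at hc; obtain ⟨t, ht, rfl⟩ := hc
    exact mem_range.2 (heptPt7_lt ⟨_, hy⟩ ⟨_, hb6⟩ ⟨t, mem_range.1 ht⟩)
  · intro c hc
    rw [mem_sdiff, mem_image] at hc
    have hn : inHept6 hb c = false := by
      unfold inHept6; rw [List.any_eq_false]; intro t ht hEq
      rw [beq_iff_eq] at hEq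
      exact hc.2 ⟨t, Finset.mem_range.2 (List.mem_range.1 ht), hEq⟩
    simp [hn]
  · intro c hc
    rw [mem_image] at hc; obtain ⟨t, ht, rfl⟩ := hc
    have hin : inHept6 hb (heptPt7 (hb / 6) (hb % 6) t) = true := by
      unfold inHept6; rw [List.any_eq_true]; exact ⟨t, List.mem_range.2 (Finset.mem_range.1 ht), by rw [beq_iff_eq]⟩
    simp [hin]

/-- The sum of a 42-vector over the points selected by a heptad is its heptad sum. -/
theorem sum_inHept6 {hb : ℕ} (hhb : hb < 48) (Q : ℕ → ℕ) :
    ∑ c ∈ range 42, (if inHept6 hb c then Q c else 0) = ∑ t ∈ range 7, Q (heptPt7 (hb / 6) (hb % 6) t) := by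
  have hy : hb / 6 < 8 := by omega
  have hb6 : hb % 6 < 6 := Nat.mod_lt _ (by norm_num)
  have hinj : ∀ t ∈ range 7, ∀ t' ∈ range 7, heptPt7 (hb / 6) (hb % 6) t = heptPt7 (hb / 6) (hb % 6) t' → t = t' := by
    intro t ht t' ht' h
    have := heptPt7_inj ⟨_, hy⟩ ⟨_, hb6⟩ ⟨t, mem_range.1 ht⟩ ⟨t', mem_range.1 ht'⟩ h
    simpa using this
  rw [← sum_image hinj]
  symm
  apply sum_subset_zero_on_sdiff
  · intro c hc; rw [mem_image] at hc; obtain ⟨t, ht, rfl⟩ := hc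
    exact mem_range.2 (heptPt7_lt ⟨_, hy⟩ ⟨_, hb6⟩ ⟨t, mem_range.1 ht⟩)
  · intro c hc
    rw [mem_sdiff, mem_image] at hc
    have hn : inHept6 hb c = false := by
      unfold inHept6; rw [List.any_eq_false]; intro t ht hEq
      rw [beq_iff_eq] at hEq
      exact hc.2 ⟨t, Finset.mem_range.2 (List.mem_range.1 ht), hEq⟩
    simp [hn]
  · intro c hc
    rw [mem_image] at hc; obtain ⟨t, ht, rfl⟩ := hc
    have hin : inHept6 hb (heptPt7 (hb / 6) (hb % 6) t) = true := by
      unfold inHept6; rw [List.any_eq_true]; exact ⟨t, List.mem_range.2 (Finset.mem_range.1 ht), by rw [beq_iff_eq]⟩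
    simp [hin]

/-- **The heptad test passes on the block vector of a slack-6 pattern.** -/
theorem hepOK6_pat {Q : ℕ → ℕ} (hQ : IsPat7 6 Q) : hepOK6 (packW 1752 Q 42) = true := by
  unfold hepOK6
  rw [List.all_eq_true]
  intro hb hhb
  have hhb' := List.mem_range.1 hhb
  rw [beq_iff_eq]
  unfold hepSum6
  have hv : ∀ c < 42, Q c < 2 ^ 12 := fun c hc => by have := hQ.1 c hc; omega
  rw [hm6_eq hhb', blocks_and_sel hv (inHept6 hb)]
  unfold ones42_6
  rw [blocks_sum41 (fun c hc => by show (if inHept6 hb c then Q c else 0) ≤ 6; split_ifs; exact hQ.1 c hc; omega)]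
  rw [sum_inHept6 hhb' Q]
  exact hQ.2 (hb / 6) (by omega) (hb % 6) (Nat.mod_lt _ (by norm_num))

/-! ## Digit expansion and the next state -/

/-- **Digit expansion.** For `g k ≤ 7` (`k < n ≤ 16`): `expL6 (packW 3 g n) = packW 12 g n`. -/
theorem expL6_eq {g : ℕ → ℕ} {n : ℕ} (hn : n ≤ 16) (hg : ∀ k < n, g k ≤ 7) : expL6 (packW 3 g n) = packW 12 g n := by
  -- extend g by zeros to 16 digits
  set G : ℕ → ℕ := fun k => if k < n then g k else 0 with hG
  have hG8 : ∀ k, G k < 8 := fun k => by simp only [hG]; split_ifs with h; exact Nat.lt_succ_of_le (hg k h); norm_num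
  have e3 : packW 3 g n = packW 3 G 16 := by
    rw [show (16 : ℕ) = n + (16 - n) by omega, packW_append, packW_congr 3 (show ∀ k < n, g k = G k from fun k hk => by simp [hG, hk])]
    rw [packW_congr 3 (show ∀ k < 16 - n, (fun k => G (n + k)) k = (fun _ => 0) k from fun k hk => by simp [hG])]
    simp [packW]
  have e12 : packW 12 g n = packW 12 G 16 := by
    rw [show (16 : ℕ) = n + (16 - n) by omega, packW_append, packW_congr 12 (show ∀ k < n, g k = G k from fun k hk => by simp [hG, hk])]
    rw [packW_congr 12 (show ∀ k < 16 - n, (fun k => G (n + k)) k = (fun _ => 0) k from fun k hk => by simp [hG])]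
    simp [packW]
  rw [e3, e12]
  -- four chunks of four octal digits
  have hnest3 : packW 3 G 16 = packW 12 (fun m => packW 3 (fun k => G (4 * m + k)) 4) 4 := by
    rw [show (12 : ℕ) = 3 * 4 by norm_num, packW_nest 3 4 (fun m k => G (4 * m + k)) 4]
    exact packW_congr 3 fun i hi => by show G i = G (4 * (i / 4) + i % 4); rw [Nat.div_add_mod]
  have hnest12 : packW 12 G 16 = packW 48 (fun m => packW 12 (fun k => G (4 * m + k)) 4) 4 := by
    rw [show (48 : ℕ) = 12 * 4 by norm_num, packW_nest 12 4 (fun m k => G (4 * m + k)) 4]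
    exact packW_congr 12 fun i hi => by show G i = G (4 * (i / 4) + i % 4); rw [Nat.div_add_mod]
  have hch : ∀ m < 4, packW 3 (fun k => G (4 * m + k)) 4 < 2 ^ 12 := fun m _ => packW_lt _ 4 fun k _ => hG8 _
  have hdig : ∀ m < 4, fld 12 (packW 3 G 16) m = packW 3 (fun k => G (4 * m + k)) 4 := fun m hm => by
    rw [hnest3, fld_packW _ hch, if_pos hm]
  have hexp : ∀ m < 4, exp4_6 (packW 3 (fun k => G (4 * m + k)) 4) = packW 12 (fun k => G (4 * m + k)) 4 := by
    intro m hm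
    have h := exp4_6_ok ⟨packW 3 (fun k => G (4 * m + k)) 4, hch m hm⟩
    rw [h]
    refine packW_congr 12 fun k hk => ?_
    show packW 3 (fun k => G (4 * m + k)) 4 / 8 ^ k % 8 = G (4 * m + k)
    have := fld_packW (W := 3) (fun k => G (4 * m + k)) (n := 4) (fun k _ => hG8 _) k
    rw [fldW_eq, if_pos hk] at this
    rw [show (8 : ℕ) ^ k = 2 ^ (3 * k) by rw [pow_mul]; norm_num, show (8 : ℕ) = 2 ^ 3 by norm_num]
    exact this
  unfold expL6
  have r0 : packW 3 G 16 % 4096 = fld 12 (packW 3 G 16) 0 := by rw [fldW_eq]; simp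
  have r1 : packW 3 G 16 / 4096 % 4096 = fld 12 (packW 3 G 16) 1 := by rw [fldW_eq]; norm_num
  have r2 : packW 3 G 16 / 2 ^ 24 % 4096 = fld 12 (packW 3 G 16) 2 := by rw [fldW_eq]; norm_num
  have r3 : packW 3 G 16 / 2 ^ 36 % 4096 = fld 12 (packW 3 G 16) 3 := by rw [fldW_eq]; norm_num
  rw [r0, r1, r2, r3, hdig 0 (by norm_num), hdig 1 (by norm_num), hdig 2 (by norm_num), hdig 3 (by norm_num),
    hexp 0 (by norm_num), hexp 1 (by norm_num), hexp 2 (by norm_num), hexp 3 (by norm_num), hnest12]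
  unfold packW
  simp [sum_range_succ]

/-- **The next state.** Appending the free code of the true column of bucket level `L ≥ 1` to the state gives the state of level `L + 1`. -/
theorem stateW6_succ {L : ℕ} (hL : L < 21) (hL1 : 1 ≤ L) (x : ℕ → ℕ) (hx : ∀ j < 21, ∀ z < 42, colN7 x j z ≤ 6) :
    stateW6 x (L + 1) = stateW6 x L + expL6 (freeCode6 L (colN7 x (torOf6 L))) * 2 ^ (12 * k6Base L) := by
  obtain ⟨hsucc, _, _, _, _, _, _⟩ := lev6_ok' hL
  have hn13 : k6NFree L ≤ 13 := (k6NFree_le L).2 hL1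
  have hdig : ∀ k < k6NFree L, colN7 x (torOf6 L) (fz6 L k) ≤ 7 := fun k hk => by
    have hk18 : k < 18 := by omega
    have := hx _ (torOf6_lt hL) _ (fz6_glob' hL hk18 hk).2.2; omega
  unfold stateW6 freeCode6
  rw [hsucc, packW_append, expL6_eq (by omega) hdig]
  rw [packW_congr 12 (show ∀ k < k6NFree L, (fun k => fvec6 x (k6Base L + k)) k = (fun k => colN7 x (torOf6 L) (fz6 L k)) k from
    fun k hk => by
      have hk18 : k < 18 := by omega
      obtain ⟨hl, hp, _⟩ := fz6_glob' hL hk18 hk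
      show fvec6 x (k6Base L + k) = colN7 x (torOf6 L) (fz6 L k)
      unfold fvec6; rw [hl, hp])]

/-- At a determined level the state does not change. -/
theorem stateW6_det {L : ℕ} (hL : L < 21) (hD : k6NFree L = 0) (x : ℕ → ℕ) : stateW6 x (L + 1) = stateW6 x L := by
  unfold stateW6; rw [(lev6_ok ⟨L, hL⟩).1, hD, add_zero]

/-- The initial state: the free counts of the torus-0 column. -/
theorem repW6_eq {c : ℕ} (x : ℕ → ℕ) (hcol : ∀ z < 42, colN7 x 0 z = repVal6 c z) : repW6 c = stateW6 x 1 := by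
  unfold repW6 stateW6 packW
  rw [list_sum_range_map, show k6Base 1 = 18 from rfl]
  refine sum_congr rfl fun k hk => ?_
  have hk' := mem_range.1 hk
  have hk0 : k < k6NFree 0 := by show k < 18; exact hk'
  obtain ⟨hl, hp, hz⟩ := fz6_glob' (L := 0) (by norm_num) hk' hk0
  show repVal6 c (fz6 0 k) * 2 ^ (12 * k) = fvec6 x k * 2 ^ (12 * k)
  unfold fvec6
  rw [show k6Base 0 + k = k from by rw [show k6Base 0 = 0 from rfl, zero_add]] at hl hp
  rw [hl, hp, torOf6_ok.2.2, hcol _ hz]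

/-- The level-2 state built by the checker from class `c` and the free code of the true level-1 column is the true state. -/
theorem state2_6_eq {c : ℕ} (x : ℕ → ℕ) (hx : ∀ j < 21, ∀ z < 42, colN7 x j z ≤ 6) (hcol : ∀ z < 42, colN7 x 0 z = repVal6 c z) :
    state2_6 c (freeCode6 1 (colN7 x (torOf6 1))) = stateW6 x 2 := by
  unfold state2_6
  rw [repW6_eq x hcol, stateW6_succ (L := 1) (by norm_num) le_rfl x hx, show 12 * k6Base 1 = 216 from rfl]

end Summit.MatrixMultiplication.OmegaCensus.SmallFormats
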